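import Summits.Ventures.PercRepro.Defs

/-!
# PercRepro — the two-map coordinate induction (p1, gen 4; proofs/P1-5a-class.md §1)

p3's Lemma-B₃ induction (`antipodalSum_nonneg`, one monotone map, base case `f(a, a) = 0`) with TWO
different monotone maps `c`, `d` on the cube and the base case replaced by the DIAGONAL condition
`0 ≤ f (c (β ⊔ B)) (d (γ ⊔ B))`: the anti-diagonal of every square `(c σ ≤ c (σ ∪ r); d τ ≤ d (τ ∪ r))`
dominates its diagonal (`hloc`), so the antipodal sum over a set of free coordinates `A` is superadditive
over the two facets of any `r ∈ A`.  No axioms on the relations `r₁`, `r₂` are needed.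
-/

namespace PercRepro

open Finset

section TwoMap

variable {S : Type*} [DecidableEq S]

/-- `cfgOf β B`: the configuration `β` with the coordinates of `B` switched on. -/
def cfgOf (β : Config S) (B : Finset S) : Config S := fun e => β e || decide (e ∈ B)

/-- Evaluation of `cfgOf`. -/
@[simp] theorem cfgOf_apply (β : Config S) (B : Finset S) (e : S) :
    cfgOf β B e = (β e || decide (e ∈ B)) := rfl

/-- Switching on nothing changes nothing. -/
theorem cfgOf_empty (β : Config S) : cfgOf β ∅ = β := by
  funext e
  simp [cfgOf]

/-- Switching on `insert r B` is switching on `r` first, then `B`. -/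
theorem cfgOf_insert (β : Config S) (r : S) (B : Finset S) :
    cfgOf β (insert r B) = cfgOf (cfgOf β {r}) B := by
  funext e
  simp only [cfgOf, Finset.mem_insert, Finset.mem_singleton]
  by_cases h1 : e = r <;> by_cases h2 : e ∈ B <;> simp [h1, h2]

/-- `cfgOf` is monotone in the switched-on set. -/
theorem cfgOf_mono (β : Config S) {B B' : Finset S} (h : B ⊆ B') : cfgOf β B ≤ cfgOf β B' := by
  intro e
  simp only [cfgOf]
  by_cases hB : e ∈ B
  · simp [hB, h hB]
  · simp only [hB, decide_false, Bool.or_false]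
    cases β e <;> simp

/-- `β ≤ cfgOf β B`. -/
theorem le_cfgOf (β : Config S) (B : Finset S) : β ≤ cfgOf β B := by
  intro e
  simp only [cfgOf]
  cases β e <;> simp

/-- **The two-map coordinate induction.** For monotone `c`, `d` (with respect to arbitrary relations
`r₁`, `r₂`), a kernel `f` whose anti-diagonals dominate its diagonals on every `(r₁, r₂)`-square, and
a nonnegative diagonal `f (c (β ⊔ B)) (d (γ ⊔ B))` on every `B ⊆ A`, the antipodal sum over the
subsets of `A` is nonnegative. -/
theorem twoMap_sum_nonneg {L₁ L₂ : Type*} (r₁ : L₁ → L₁ → Prop) (r₂ : L₂ → L₂ → Prop)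
    (f : L₁ → L₂ → ℝ)
    (hloc : ∀ a₀ a₁ b₀ b₁, r₁ a₀ a₁ → r₂ b₀ b₁ → f a₀ b₀ + f a₁ b₁ ≤ f a₀ b₁ + f a₁ b₀)
    (c : Config S → L₁) (d : Config S → L₂)
    (hc : ∀ σ σ' : Config S, σ ≤ σ' → r₁ (c σ) (c σ'))
    (hd : ∀ τ τ' : Config S, τ ≤ τ' → r₂ (d τ) (d τ'))
    (A : Finset S) :
    ∀ β γ : Config S, (∀ B ⊆ A, 0 ≤ f (c (cfgOf β B)) (d (cfgOf γ B))) →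
      0 ≤ ∑ B ∈ A.powerset, f (c (cfgOf β B)) (d (cfgOf γ (A \ B))) := by
  induction A using Finset.induction_on with
  | empty =>
    intro β γ hdiag
    simpa [Finset.powerset_empty, cfgOf_empty] using hdiag ∅ (Finset.Subset.refl _)
  | insert r A hr ih =>
    intro β γ hdiag
    rw [Finset.sum_powerset_insert hr]
    -- the two induction hypotheses: offsets `(β, γ)` and `(β ⊔ r, γ ⊔ r)`
    have ih₁ := ih β γ (fun B hB => hdiag B (hB.trans (Finset.subset_insert r A)))
    have ih₂ := ih (cfgOf β {r}) (cfgOf γ {r}) (fun B hB => by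
      have := hdiag (insert r B) (Finset.insert_subset_insert r hB)
      rwa [cfgOf_insert, cfgOf_insert] at this)
    -- every square contributes its anti-diagonal
    have key : ∀ B ∈ A.powerset,
        f (c (cfgOf β B)) (d (cfgOf γ (A \ B))) +
            f (c (cfgOf (cfgOf β {r}) B)) (d (cfgOf (cfgOf γ {r}) (A \ B))) ≤
          f (c (cfgOf β B)) (d (cfgOf γ (insert r A \ B))) +
            f (c (cfgOf β (insert r B))) (d (cfgOf γ (insert r A \ insert r B))) := by
      intro B hB
      have hrB : r ∉ B := fun h => hr (Finset.mem_powerset.1 hB h)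
      rw [Finset.insert_sdiff_of_notMem _ hrB, Finset.insert_sdiff_insert,
        Finset.sdiff_insert_of_notMem hr, ← cfgOf_insert, ← cfgOf_insert]
      exact hloc _ _ _ _ (hc _ _ (cfgOf_mono β (Finset.subset_insert r B)))
        (hd _ _ (cfgOf_mono γ (Finset.subset_insert r (A \ B))))
    calc (0 : ℝ) ≤ ∑ B ∈ A.powerset, f (c (cfgOf β B)) (d (cfgOf γ (A \ B))) +
          ∑ B ∈ A.powerset, f (c (cfgOf (cfgOf β {r}) B)) (d (cfgOf (cfgOf γ {r}) (A \ B))) :=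
          add_nonneg ih₁ ih₂
      _ = ∑ B ∈ A.powerset, (f (c (cfgOf β B)) (d (cfgOf γ (A \ B))) +
            f (c (cfgOf (cfgOf β {r}) B)) (d (cfgOf (cfgOf γ {r}) (A \ B)))) :=
          (Finset.sum_add_distrib).symm
      _ ≤ ∑ B ∈ A.powerset, (f (c (cfgOf β B)) (d (cfgOf γ (insert r A \ B))) +
            f (c (cfgOf β (insert r B))) (d (cfgOf γ (insert r A \ insert r B)))) :=
          Finset.sum_le_sum key
      _ = _ := Finset.sum_add_distrib

end TwoMap

end PercRepro
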